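import Mathlib.Algebra.Group.Subgroup.Pointwise
import Mathlib.GroupTheory.Commutator.Basic
import Mathlib.Topology.Algebra.Group.Basic
import Literature.AnabelianGeometry.AbsoluteAnabelian.FundamentalExtension
import HarnessLib

/-!
# [AbsCusp]: cuspidal subgroups, maximal cuspidally central quotients, cuspidalization statements

S. Mochizuki, *Absolute anabelian cuspidalizations of proper hyperbolic curves*, J. Math. Kyoto
Univ. 47 (2007) 451–539 [cite: MochizukiAbsCusp2007, Def 1.1 (i) p.10]; locators `p.N` are pages of
the held copy (94 pp., lit key `paper:doi-10-1215-kjm-1250281022`).  Cell abc-iut, layer L4, block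
W2-B12 = plan/L4/LC1-CHAIN.md §2 missing link M3, [AbsCusp] part: the external inputs that
[AbsTopIII] Prop. 1.4 (ii) p. 31, Prop. 1.6 p. 35 and Cor. 1.10 (iii)(f)(g) p. 43 cite by number —
Def. 1.1 (i), Prop. 1.2 (i), Prop. 1.6 (iii), Thm. 1.1 (iii), Def. 2.1 + Rmk. 15, Prop. 2.1 (i)(ii),
Prop. 2.2 (i), Thm. 2.1 (i).  Companion of `GaloisSectionsFacts.lean` ([GalSect] part).

## Setting of [AbsCusp] §1 (p. 6) and how it is typed

"Let `X` be a proper hyperbolic curve over a field `k` which is either finite or nonarchimedean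
local … `Σ` a set of prime numbers that contains at least one prime number that is invertible in
`k` … `Δ_X` the maximal pro-`Σ` quotient of `π₁(X_{k̄})` and `Π_X := π₁(X)/Ker(π₁(X_{k̄}) ↠ Δ_X)`.
Thus, we have an exact sequence `1 → Δ_X → Π_X → G_k → 1`."  As in the whole L4 layer (typing
policy θ, plan/L4/ASSIGNMENTS.md §2), the étale `π₁` is not in the tree: GROUP-THEORETIC notions
are REAL definitions over Mathlib (Def. 1.1) or over abc-iut-L4-t1's interface
`FundamentalExtension` (`E.arith = Π`, `E.gal = G_k`, `E.geom = Δ`; homomorphisms of extensions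
`E ⟶ F`; `CuspidalData`), and the RESULTS are predicates on such data (shape (1)) whose
docstrings quote print; the model-relative closed forms ("for every proper hyperbolic curve over
a finite or nonarchimedean local field …", shape (M) over t1's `CurveModel`, p405053 pending) are
deferred to the merge pass.  Junk data only falsify their own instance.

## Index (item → page → status)
* Def. 1.1 (i) p. 10 (cuspidal subgroup `I_H`; cuspidally abelian / central) → REAL:
  `AbsCusp.cuspidalSubgroup`, `IsCuspidallyAbelian`, `IsCuspidallyCentral` (+ PROVED: central ⇒
  abelian); "cuspidally pro-`Σ*`" not typed (pro-`Σ` groups: abc-iut-L4-t6's `IsProSigmaGroup`,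
  TODO-merge).  Def. 1.1 (ii) p. 10–11 (`H₁`-inner automorphisms, `H₁`-outer homomorphisms;
  geometrically / cuspidally inner) → REAL: `IsInnerBy`, `OuterRel` (+ PROVED: an equivalence
  relation), `IsCuspidallyInnerAut`.
* Def. 1.1 (i) "maximal cuspidally central quotient" (the notion [AbsTopIII] Prop. 1.4 (ii) quotes)
  → `AbsCusp.cuspidallyCentralModulus` (`[I_H, H]⁻`; for `H → Π_X` with `H = Π_U` this is t1's
  `AbsTopIII.cuspidallyCentralModulus`, pending in `CurveModel.lean` — TODO-merge: t1's copy is the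
  `Δ`-commutator `[N ∩ Δ, Δ]⁻`; here the printed one, relative to an arbitrary `H → Π`).
* Prop. 1.6 (iii) p. 15, last sentence (cited by [AbsTopIII] Prop. 1.4 (ii) p. 32) →
  `AbsCusp.Prop_1_6_iii`: for `S ⊆ X(k)` finite and `U_S = X ∖ S`, the maximal cuspidally central
  quotient of `Δ_{U_S} ↠ Δ_X` is `D_S`, an extension of `Δ_X` by `∏_{x∈S} M_X` with `M_X ≅ I_x`:
  typed as the group-theoretic shape "the inertia groups `I_x`, `x ∈ S`, map injectively and
  independently into `Δ_{U_S}/[N, Δ_{U_S}]⁻` and generate `N/[N, Δ_{U_S}]⁻`", `N = Ker(Δ_{U_S} ↠ Δ_X)`.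
* Thm. 1.1 (iii) p. 27 and Thm. 2.1 (i) p. 42 (maximal cuspidally abelian quotients
  `Π^{c-ab}_{U_{X×X}}`, `Π^{c-ab}_{U_S}` reconstructed from `Π_X`, functorially in isomorphisms
  `α : Π_X ⥲ Π_Y`; cited by [AbsTopIII] Cor. 1.10 (iii)(f)) → `AbsCusp.CuspidalizationData`
  (INTERFACE: the profinite group `Π_{U}` over `Π` for the relevant opens, an absent deep input)
  and the predicates `Thm_1_1_iii`, `Thm_2_1_i` (existence of isomorphisms of the maximal
  cuspidally abelian quotients lying over `α × α`, resp. `α`; the clause "functorial up to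
  cuspidally inner automorphisms" is recorded, see the docstrings — TODO(general form)).
* Prop. 1.2 (i) p. 8 (top cohomology `H^{d_k}(G_k, M_k) ≅ Ẑ†`, `H²(Δ_X, M_X) ≅ Ẑ†`, …),
  Prop. 2.1 (i)(ii) p. 35–36 (Kummer classes `Γ(U_S, 𝒪^×) → H¹(Π^{c-cn}_{U_S}, M_X) ⥲ H¹(Π^{c-ab}_{U_S}, M_X) ⥲
  H¹(Π_{U_S}, M_X)`; the exact sequence `1 → (k^×)^∧ → H¹(Π_{U_S}, M_X) → ⊕_{x∈S} Ẑ†` and the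
  principal-divisor characterisation), Def. 2.1 p. 37 + Rmk. 15 p. 38 (Green's trivializations
  `γ_{y,x} : G_k → D_{y,x}`, symmetric under `Π^{c-ab}_τ`), Prop. 2.2 (i) p. 39 (`D` principal iff
  `η_D = 0` in `H¹(G_k, Δ_X^{ab})`) — RECORDED BY LOCATOR ONLY in this file: each is a statement
  about CONTINUOUS GROUP COHOMOLOGY `H^i(Π, M_X)` of profinite groups with profinite coefficients,
  for which the tree's vehicle is abc-iut-L4-t1's `continuousCohomology`-based `geomCyclotomeH1`
  (`AbsTopIII/CuspidalCyclotome.lean`, staged, waits for `CurveModel`); they are typed in the merge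
  pass over those objects (no abstract cohomology datum is introduced here — it would be vacuous).
HONEST FRAMING: refereed, undisputed results entered statements-first (D-0014); typed ≠ discharged;
nothing here takes a side on [IUTchIII] Cor. 3.12.
-/

noncomputable section

open scoped Classical Pointwise

namespace Literature.AnabelianGeometry.AbsoluteAnabelian

namespace AbsCusp

universe u v

/-! ### Definition 1.1 (i), p. 10 — cuspidal subgroups (pure group theory, REAL) -/

section Def11

variable {H : Type u} {P : Type v} [Group H] [Group P]

/-- Def. 1.1 (i): "Let `H` be a profinite group equipped with a homomorphism `H → Π_X`.  Then we
shall refer to the kernel `I_H` of `H → Π_X` as the *cuspidal subgroup* of `H` [relative to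
`H → Π_X`]" (also "when `Π_X` is replaced by `Δ_X`, `Π_{X×X}`, `Δ_{X×X}`" — here: by any group
`P`). [cite: MochizukiAbsCusp2007, Def 1.1 (i) p.10] -/
def cuspidalSubgroup (f : H →* P) : Subgroup H := f.ker

/-- The cuspidal subgroup is normal. [cite: MochizukiAbsCusp2007, Def 1.1 (i) p.10] -/
instance cuspidalSubgroup_normal (f : H →* P) : (cuspidalSubgroup f).Normal :=
  inferInstanceAs f.ker.Normal

/-- Def. 1.1 (i): "`H` is *cuspidally abelian* … [relative to `H → Π_X`] if `I_H` is abelian".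
[cite: MochizukiAbsCusp2007, Def 1.1 (i) p.10] -/
@[mk_iff] structure IsCuspidallyAbelian (f : H →* P) : Prop where
  /-- `I_H` is abelian -/
  comm : ∀ a ∈ cuspidalSubgroup f, ∀ b ∈ cuspidalSubgroup f, a * b = b * a

/-- Def. 1.1 (i): "If `H` is cuspidally abelian, then … `H/I_H` acts naturally [by conjugation] on
`I_H`; we shall say that `H` is *cuspidally central* [relative to `H → Π_X`] if this action of
`H/I_H` on `I_H` is trivial" — equivalently (for abelian `I_H`, and then in general) `I_H` lies in
the centre of `H`. [cite: MochizukiAbsCusp2007, Def 1.1 (i) p.10] -/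
@[mk_iff] structure IsCuspidallyCentral (f : H →* P) : Prop where
  /-- `I_H ⊆ Z(H)` -/
  le_center : cuspidalSubgroup f ≤ Subgroup.center H

/-- Cuspidally central implies cuspidally abelian (the text defines "central" only for cuspidally
abelian `H`; with `I_H ⊆ Z(H)` this is automatic). [cite: MochizukiAbsCusp2007, Def 1.1 (i) p.10] -/
theorem IsCuspidallyCentral.isCuspidallyAbelian {f : H →* P} (h : IsCuspidallyCentral f) :
    IsCuspidallyAbelian f :=
  ⟨fun _ ha b _ => ((Subgroup.mem_center_iff.mp (h.le_center ha)) b).symm⟩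

variable [TopologicalSpace H] [IsTopologicalGroup H]

/-- The closed normal subgroup `[I_H, H]⁻` (closure of the commutator of the cuspidal subgroup
with `H`): `H/[I_H, H]⁻` is "the maximal cuspidally central quotient" of `H → Π_X` (Def. 1.1 (i);
the phrase [AbsTopIII] Prop. 1.4 (ii) p. 31 quotes: "the maximal intermediate quotient
`Δ_{U_x} ↠ Q ↠ Δ_X` such that `Ker(Q ↠ Δ_X)` lies in the center of `Q`").  TODO-merge
abc-iut-L4-t1 `AbsTopIII.cuspidallyCentralModulus` (same object for `H = Π_U → Π_X`, written
there inside `Δ_U`). [cite: MochizukiAbsCusp2007, Def 1.1 (i) p.10] -/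
def cuspidallyCentralModulus (f : H →* P) : Subgroup H :=
  (⁅cuspidalSubgroup f, (⊤ : Subgroup H)⁆).topologicalClosure

/-- `[I_H, H]⁻ ≤ I_H` (the cuspidal subgroup is normal and closed when `P` is Hausdorff and `f`
continuous; here only normality is used, closure taken inside the closed `I_H`).
[cite: MochizukiAbsCusp2007, Def 1.1 (i) p.10] -/
theorem cuspidallyCentralModulus_le [TopologicalSpace P] [T1Space P] (f : H →* P)
    (hf : Continuous f) : cuspidallyCentralModulus f ≤ cuspidalSubgroup f := by
  have hclosed : IsClosed (cuspidalSubgroup f : Set H) := by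
    change IsClosed ((f : H → P) ⁻¹' {1})
    exact isClosed_singleton.preimage hf
  have hle : ⁅cuspidalSubgroup f, (⊤ : Subgroup H)⁆ ≤ cuspidalSubgroup f :=
    Subgroup.commutator_le_left _ _
  exact (Subgroup.topologicalClosure_minimal _ hle hclosed)

end Def11

/-! ### Definition 1.1 (ii), p. 10–11 — `H₁`-inner automorphisms, `H₁`-outer homomorphisms -/

section Def11ii

variable {H : Type u} {H' : Type v} [Group H] [Group H']

/-- Def. 1.1 (ii): "we shall refer to as an `H₁`-*inner automorphism* of `H` an inner
automorphism induced by conjugation by an element of `H₁`" (`H₁ ⊆ H` a closed subgroup).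
[cite: MochizukiAbsCusp2007, Def 1.1 (ii) p.10] -/
def IsInnerBy (H₁ : Subgroup H) (φ : H ≃* H) : Prop :=
  ∃ h ∈ H₁, ∀ x, φ x = h * x * h⁻¹

/-- Def. 1.1 (ii): two homomorphisms `H' → H` define the same `H₁`-*outer homomorphism* iff
"they differ by composition by an `H₁`-inner automorphism".
[cite: MochizukiAbsCusp2007, Def 1.1 (ii) p.10] -/
def OuterRel (H₁ : Subgroup H) (f g : H' →* H) : Prop :=
  ∃ h ∈ H₁, ∀ x, g x = h * f x * h⁻¹

/-- `OuterRel H₁` is an equivalence relation (so "`H₁`-outer homomorphisms `H' → H`" are its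
classes). [cite: MochizukiAbsCusp2007, Def 1.1 (ii) p.10] -/
theorem outerRel_equivalence (H₁ : Subgroup H) : Equivalence (OuterRel (H' := H') H₁) where
  refl f := ⟨1, H₁.one_mem, fun x => by simp⟩
  symm := by
    rintro f g ⟨h, hh, hfg⟩
    refine ⟨h⁻¹, H₁.inv_mem hh, fun x => ?_⟩
    rw [hfg x]; group
  trans := by
    rintro f g k ⟨h, hh, hfg⟩ ⟨h', hh', hgk⟩
    refine ⟨h' * h, H₁.mul_mem hh' hh, fun x => ?_⟩
    rw [hgk x, hfg x]; group

/-- The setoid of `H₁`-outer homomorphisms `H' → H`. [cite: MochizukiAbsCusp2007, Def 1.1 (ii) p.10] -/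
def outerSetoid (H₁ : Subgroup H) : Setoid (H' →* H) := ⟨OuterRel H₁, outerRel_equivalence H₁⟩

/-- Def. 1.1 (ii): for `H` "equipped with a homomorphism to `Π_X` … and `H₁` the kernel of this
homomorphism", an `H₁`-inner automorphism is a *cuspidally inner automorphism*; likewise
"geometrically inner" for `H₁ = Ker(H → G_k)`. [cite: MochizukiAbsCusp2007, Def 1.1 (ii) p.11] -/
def IsCuspidallyInnerAut {P : Type v} [Group P] (f : H →* P) (φ : H ≃* H) : Prop :=
  IsInnerBy (cuspidalSubgroup f) φ

end Def11ii

/-! ### Proposition 1.6 (iii), p. 15 — the maximal cuspidally central quotient of `Δ_{U_S}` -/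

section Prop16

variable {E F : FundamentalExtension.{u}}

/-- Prop. 1.6 (iii), last sentence, as a property of the group data of `U_S = X ∖ S ⊆ X` (`X` a
proper hyperbolic curve over a finite or nonarchimedean local field `k`, `S ⊆ X(k)` a finite
subset — hypotheses on the CURVE, carried by the (M)-wrapper): `q : Π_{U_S} ↠ Π_X` the natural
surjection of extensions, `I x ⊆ Δ_{U_S}` the inertia group of the cusp `x ∈ S`.  Printed: "the
composite morphism `Π_{U_S} → D_S` is surjective; the resulting quotient of
`Δ_{U_S} := Ker(Π_{U_S} ↠ G_k)` is the maximal cuspidally central quotient of `Δ_{U_S}`, relative to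
the surjection `Δ_{U_S} ↠ Δ_X`", where `D_S = ∏_{x ∈ S} D_x` (fibre product over `Π_X`) is an
extension of `Π_X` by `∏_{x∈S} M_X` and `M_X = I_x[U_S]` (Prop. 2.1 p. 35).  Group-theoretic shape
typed: with `N = Ker(Δ_{U_S} ↠ Δ_X)` and `[N, Δ_{U_S}]⁻` the modulus, (a) the `I x` together with
the modulus generate `N`; (b) each `I x` meets the subgroup generated by the modulus and the other
`I y` trivially (so `N/[N, Δ]⁻ = ∏_{x∈S} I_x`, each `I_x` injecting).
[cite: MochizukiAbsCusp2007, Prop 1.6 (iii) p.15] -/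
def Prop_1_6_iii (q : E ⟶ F) {S : Type u} (I : S → Subgroup E.arith) : Prop :=
  let Δ : Subgroup E.arith := E.geom
  let N : Subgroup E.arith := q.arith.toMonoidHom.ker ⊓ Δ
  let C : Subgroup E.arith := (⁅N, Δ⁆).topologicalClosure
  Function.Surjective q.arith ∧ (∀ x, I x ≤ N) ∧ (⨆ x, I x) ⊔ C = N ∧
    ∀ x, I x ⊓ ((⨆ (y : S) (_ : y ≠ x), I y) ⊔ C) = ⊥

end Prop16

/-! ### Theorem 1.1 (iii) p. 27 and Theorem 2.1 (i) p. 42 — cuspidalizations as an interface -/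

section Cuspidalizations

variable {E F : FundamentalExtension.{u}}

/-- INTERFACE (absent deep input): the arithmetic fundamental group `Π_U` of an open `U` of (a
product of copies of) the proper curve, as a profinite group OVER `Π` — in the text
`Π_{U_{X×X}} ↠ Π_{X×X} = Π_X ×_{G_k} Π_X` (p. 11, `U_{X×X}` = complement of the diagonal) and
`Π_{U_S} ↠ Π_X` (Prop. 1.6 (iii)).  Fields: the group, the surjection, and (Def. 1.1 (i)) its
maximal cuspidally ABELIAN quotient presented by the closed normal subgroup `[I, I]⁻`.
[cite: MochizukiAbsCusp2007, Thm 1.1 (iii) p.27] -/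
structure CuspidalizationData (P : Type u) [Group P] [TopologicalSpace P] : Type (u + 1) where
  /-- `Π_U` -/
  grp : ProfiniteGrp.{u}
  /-- `Π_U ↠ Π` (resp. `↠ Π_{X×X}`) -/
  proj : grp →ₜ* P
  /-- it is surjective -/
  proj_surjective : Function.Surjective proj

namespace CuspidalizationData

variable {P : Type u} [Group P] [TopologicalSpace P]

/-- The cuspidal subgroup `I = Ker(Π_U ↠ Π)` (Def. 1.1 (i)). [cite: MochizukiAbsCusp2007, Def 1.1 (i) p.10] -/
def cuspidal (D : CuspidalizationData P) : Subgroup D.grp := cuspidalSubgroup D.proj.toMonoidHom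

/-- `I` is normal in `Π_U`. [cite: MochizukiAbsCusp2007, Def 1.1 (i) p.10] -/
instance cuspidal_normal (D : CuspidalizationData P) : D.cuspidal.Normal :=
  inferInstanceAs (cuspidalSubgroup D.proj.toMonoidHom).Normal

/-- `[I, I]⁻`: dividing `Π_U` by it gives "the maximal cuspidally abelian quotient `Π^{c-ab}_U`"
(Thm. 1.1 (iii) p. 27; Prop. 2.1 p. 35). [cite: MochizukiAbsCusp2007, Thm 1.1 (iii) p.27] -/
def cuspidallyAbelianModulus (D : CuspidalizationData P) : Subgroup D.grp :=
  (⁅D.cuspidal, D.cuspidal⁆).topologicalClosure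

/-- `[I, I]⁻` is normal in `Π_U`. [cite: MochizukiAbsCusp2007, Thm 1.1 (iii) p.27] -/
instance cuspidallyAbelianModulus_normal (D : CuspidalizationData P) :
    D.cuspidallyAbelianModulus.Normal := by
  have : (⁅D.cuspidal, D.cuspidal⁆).Normal := Subgroup.commutator_normal _ _
  exact Subgroup.is_normal_topologicalClosure _

/-- The maximal cuspidally abelian quotient `Π^{c-ab}_U := Π_U / [I, I]⁻`.
[cite: MochizukiAbsCusp2007, Thm 1.1 (iii) p.27] -/
abbrev MaxCuspAbelian (D : CuspidalizationData P) : Type u := D.grp ⧸ D.cuspidallyAbelianModulus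

/-- `[I, I]⁻ ≤ I` when `Π` is Hausdorff (so `Π^{c-ab}_U` still maps onto `Π`).
[cite: MochizukiAbsCusp2007, Thm 1.1 (iii) p.27] -/
theorem cuspidallyAbelianModulus_le [T1Space P] (D : CuspidalizationData P) :
    D.cuspidallyAbelianModulus ≤ D.cuspidal := by
  have hclosed : IsClosed (D.cuspidal : Set D.grp) := by
    change IsClosed ((D.proj : D.grp → P) ⁻¹' {1})
    exact isClosed_singleton.preimage D.proj.continuous
  exact Subgroup.topologicalClosure_minimal _ (Subgroup.commutator_le_left _ _) hclosed

/-- The induced surjection `Π^{c-ab}_U ↠ Π`. [cite: MochizukiAbsCusp2007, Thm 1.1 (iii) p.27] -/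
def projAb [T1Space P] (D : CuspidalizationData P) : D.MaxCuspAbelian →* P :=
  QuotientGroup.lift _ D.proj.toMonoidHom fun _ hx => D.cuspidallyAbelianModulus_le hx

end CuspidalizationData

/-- The fibre product `Π_X ×_{G_k} Π_X = Π_{X×X}` (p. 6: "`Π_{X×X}` … may be identified with
`Π_X ×_{G_k} Π_X`"), as a subgroup of `Π_X × Π_X`. [cite: MochizukiAbsCusp2007, §1 p.6] -/
def squareGroup (E : FundamentalExtension.{u}) : Subgroup (E.arith × E.arith) where
  carrier := {p | E.aug p.1 = E.aug p.2}
  one_mem' := by simp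
  mul_mem' := by
    intro a b ha hb
    simp only [Set.mem_setOf_eq, Prod.fst_mul, Prod.snd_mul, map_mul] at *
    rw [ha, hb]
  inv_mem' := by
    intro a ha
    simp only [Set.mem_setOf_eq, Prod.fst_inv, Prod.snd_inv, map_inv] at *
    rw [ha]

/-- An isomorphism `α : Π_X ⥲ Π_Y` compatible with the quotients `G` (Thm. 1.1 (ii)) induces
`α × α : Π_{X×X} ⥲ Π_{Y×Y}` on the fibre products; here as the underlying function on pairs.
[cite: MochizukiAbsCusp2007, Thm 1.1 (iii) p.27] -/
def squareMap (α : E.arith ≃ₜ* F.arith) (p : E.arith × E.arith) : F.arith × F.arith :=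
  (α p.1, α p.2)

/-- Thm. 1.1 (iii), as a property of the cuspidalization data `Π_{U_{X×X}} ↠ Π_{X×X}` of two
PROPER hyperbolic curves `X`, `Y` over finite or nonarchimedean local fields and of an isomorphism
of profinite groups `α : Π_X ⥲ Π_Y` (lying over `G_{k_X} ⥲ G_{k_Y}`, Thm. 1.1 (ii)): "there is a
commutative diagram [well-defined up to cuspidally inner automorphisms] `Π^{c-ab}_{U_{X×X}} ⥲
Π^{c-ab}_{U_{Y×Y}}` over `α × α : Π_{X×X} ⥲ Π_{Y×Y}` — where the horizontal arrows are
isomorphisms which are compatible with the natural inclusions `D_X ↪ Π^{c-ab}_{U_{X×X}}`,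
`D_Y ↪ Π^{c-ab}_{U_{Y×Y}}` …  Finally, the correspondence `α ↦ α^{c-ab}` is functorial [up to
cuspidally inner automorphisms] with respect to `α`."  Typed: existence of an isomorphism of the
maximal cuspidally abelian quotients lying over `α × α` and carrying the given diagonal
decomposition group `D_X` onto `D_Y`.
-- TODO(general form): the functoriality of `α ↦ α^{c-ab}` (a compatible choice for composites).
[cite: MochizukiAbsCusp2007, Thm 1.1 (iii) p.27] -/
def Thm_1_1_iii (DX : CuspidalizationData (squareGroup E)) (DY : CuspidalizationData (squareGroup F))
    (diagX : Subgroup DX.MaxCuspAbelian) (diagY : Subgroup DY.MaxCuspAbelian) : Prop :=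
  ∀ (α : E.arith ≃ₜ* F.arith) (αG : E.gal ≃ₜ* F.gal), (∀ g, F.aug (α g) = αG (E.aug g)) →
    ∃ β : DX.MaxCuspAbelian ≃* DY.MaxCuspAbelian,
      (∀ z, ((DY.projAb (β z) : squareGroup F) : F.arith × F.arith) =
          squareMap α ((DX.projAb z : squareGroup E) : E.arith × E.arith)) ∧
        diagX.map β.toMonoidHom = diagY

/-- Thm. 2.1 (i), as a property of the cuspidalization data `Π_{U_S} ↠ Π_X`, `Π_{V_T} ↠ Π_Y` for
finite sets of closed points `S ⊆ X^{cl}`, `T ⊆ Y^{cl}` "that correspond via the bijection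
`X^{cl} ⥲ Y^{cl}` induced by `α`" (in "the situation of Theorem 1.1, (iii)", with
`Σ_X = Σ_Y` and `α` point-theoretic — hypotheses on the curves/`α`, carried by the (M)-wrapper):
"`α`, `α^{c-ab}` induce isomorphisms [well-defined up to cuspidally inner automorphisms]
`Π^{c-ab}_{U_S} ⥲ Π^{c-ab}_{V_T}` [where `V_T = Y ∖ T`] lying over `α`, which are functorial with
respect to `α` and `S`, `T`, as well as with respect to passing to connected finite étale
coverings".  Typed, for a GIVEN `α` (the one under which `S` and `T` correspond): existence of
an isomorphism of the maximal cuspidally abelian quotients lying over `α`.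
-- TODO(general form): the functoriality clauses. [cite: MochizukiAbsCusp2007, Thm 2.1 (i) p.42] -/
def Thm_2_1_i (DS : CuspidalizationData E.arith) (DT : CuspidalizationData F.arith)
    (α : E.arith ≃ₜ* F.arith) : Prop :=
  ∃ β : DS.MaxCuspAbelian ≃* DT.MaxCuspAbelian, ∀ z, DT.projAb (β z) = α (DS.projAb z)

end Cuspidalizations

end AbsCusp

end Literature.AnabelianGeometry.AbsoluteAnabelian
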